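import Summits.QuantumFields.YangMills.Theorems.LuscherReductionTwistedTraceScalingBTGaussianProfile
import Summits.QuantumFields.YangMills.Theorems.LuscherReductionTwistedTraceScalingBTFibreProfile
import Summits.QuantumFields.YangMills.Theorems.LuscherReductionTwistedTraceScalingChartTransport
import HarnessLib

/-!
# Definitions for the GAUSSIAN PROFILE NUMBERS of the rate twin: the profile of record `gaussProfile`, the anisotropic quadratic level `balLevel`, the reference core `coreBox`
# (route `FlatTubeReduction`, crux K1 `NearFlatRatioLaw` stmt-QuantumFields-24720; seat `ym-line-ftr-p1` g16; rate twin «ratepack-v5»; R2b1 RECORD rung — no summit statement is proved here)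

WHY (memo `Cruxes/NearFlatRatioLaw/Lines/ratepack-v5-nearpair-g16.md` §5; NOTES `## PKG-R`).  The hN/W package of the rate twin at fibre radius `r_B = btLog β·β^{-1/2}` is fed by the
«profile numbers» of `…ExactDressingOfProfileNumbersSq.exactDressing_of_profileNumbers_sq` (mass fractions, moments and tails of the profile relative to the `β^{-1/2}`-core), which for
the stiff Gaussian profile are constants: Lebesgue scaling on the balanced subspace + the flat density of the transverse measure («(E′)-lite», `…OrthoDensity.orthoTransverse_two_sided`).
This file fixes the three objects:
* `gaussProfile L β x = frozenProfile L (β ↦ q_{β/2,β}) (β ↦ btLog β·powScale (1/2) β) β x` — the frozen stiff Gaussian profile `e^{−‖P_Γx‖²/(powScale 1 β)²}·e^{−q_{β/2,β}(x)}·𝟙{‖x‖ ≤ r_B}`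
  (`q_{t,b}` = `Stiff.stiffGaussExp`, the exponent of the harmonic stiff ground state) — the profile of record of the rate twin («ratepack-v5»);
* `balLevel L β v = β²‖P_Γx‖² + β‖x − P_Γx‖²`, `x = linkEmbed L v` — the anisotropic quadratic level whose exponentials sandwich the profile (gauge width `β⁻¹`, stiff width `β^{-1/2}`);
  its sublevel sets scale exactly, `{balLevel ≤ t} = √t·{balLevel ≤ 1}`, which is what makes the profile numbers `β`-free;
* `coreBox L β` — the reference fibre core of the package: capped balanced `v` with `‖linkEmbed L v‖ ≤ (√β)⁻¹` and all coordinates `|v_{e,c}| ≤ (√β)⁻¹`;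
* `recordProfile L` (appended) — lane A's cap-balanced record profile `𝟙{linkCurry x ∈ capBalancedSet}·frozenProfile L q (min (1/40) (powScale (1/2)·btLog))`, named (the
  expression lane A writes inline; `rfl`-equal), the profile the rate twin's package is run with.
HONEST FRAMING: definitions only; femto rung R2b1 (RECORD label); not infinite volume, not a gap, not Clay.  No named facts, no `sorry`.
-/

set_option autoImplicit false

noncomputable section

open MeasureTheory Filter Topology Real
open scoped BigOperators
open Literature.MathematicalPhysics.QuantumFieldTheory
open Literature.MathematicalPhysics.QuantumLattice

namespace Summit.QuantumFields.YangMills.Theorems.FemtoTransferGap.TwoLattice.ConstTube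

open Summit.QuantumFields.YangMills.Theorems.FemtoTransferGap
open Summit.QuantumFields.YangMills.Theorems.FemtoTransferGap.TwoLattice.Stiff

variable (L : ℕ) [NeZero L]

/-- **The profile of record of the rate twin**: the frozen stiff Gaussian profile `e^{−‖P_Γx‖²/(powScale 1 β)²}·e^{−q_{β/2,β}(x)}·𝟙{‖x‖ ≤ btLog β·powScale (1/2) β}`.
[cite: Luscher1983, §3] -/
def gaussProfile (β : ℝ) (x : LinkSpace L) : ℝ :=
  frozenProfile L (fun β => stiffGaussExp L (β / 2) β) (fun β => btLog β * powScale (1 / 2) β) β x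

/-- **The anisotropic quadratic level** `β²‖P_Γx‖² + β‖x − P_Γx‖²` of a transverse coordinate vector (`x = linkEmbed L v`, `P_Γ` the orthogonal projection onto the gauge modes).
[folklore] -/
def balLevel (β : ℝ) (v : Edge 3 L → Fin 3 → ℝ) : ℝ :=
  β ^ 2 * ‖(gaugeModes L).starProjection (linkEmbed L v)‖ ^ 2 + β * ‖linkEmbed L v - (gaugeModes L).starProjection (linkEmbed L v)‖ ^ 2

/-- **The reference fibre core** of the package at inverse-root scale: capped balanced `v` with `‖linkEmbed L v‖ ≤ (√β)⁻¹` and `|v_{e,c}| ≤ (√β)⁻¹`. [folklore] -/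
def coreBox (β : ℝ) : Set (Edge 3 L → Fin 3 → ℝ) :=
  {v | v ∈ capBalancedSet L ∧ ‖linkEmbed L v‖ ≤ (Real.sqrt β)⁻¹ ∧ ∀ (e : Edge 3 L) (c : Fin 3), |v e c| ≤ (Real.sqrt β)⁻¹}

/-- **The record fibre profile** (lane A's profile of record, written there inline): the cap-balanced restriction of the frozen stiff Gaussian profile at lane A's fibre radius
`r_B = min (1/40) (powScale (1/2) β·btLog β)` — `𝟙{linkCurry x ∈ capBalancedSet}·e^{−‖P_Γx‖²/(powScale 1 β)²}·e^{−q_{β/2,β}(x)}·𝟙{‖x‖ ≤ r_B}`.  Named here so that the rate twin's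
package theorems can be stated readably; `recordProfile L = fun β x => …` is `rfl`, so lane A's lemmas (`recordGamma_eq`, `recordGamma_record_pos`, `…BOCapProfile`) apply verbatim.
[cite: Luscher1983, §3] -/
def recordProfile (β : ℝ) (x : LinkSpace L) : ℝ :=
  {x : LinkSpace L | GnChart.linkCurry x ∈ capBalancedSet L}.indicator (fun _ => (1 : ℝ)) x *
    frozenProfile L (fun β' => stiffGaussExp L (β' / 2) β') (fun β' => min (1 / 40) (powScale (1 / 2) β' * btLog β')) β x

end Summit.QuantumFields.YangMills.Theorems.FemtoTransferGap.TwoLattice.ConstTube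

end
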